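import Summits.KontsevichZagierPeriods.KontsevichZagierPeriods.Theorems.CobordismMoveZeroCombination
import Literature.NumberTheory.Transcendental.KZDominatedFamilyRelations
import Literature.NumberTheory.Transcendental.SemialgebraicLineDeriv
import Mathlib.MeasureTheory.Function.Jacobian

/-!
# `SignedSheetTransfer` (stmt-KontsevichZagierPeriods-5567, route CobordismMove) — strategist line `split`

CHECKED SKELETON of the typed decomposition

  `SignedSheetTransfer ⇐ SignedSheetPushforward ∧ SignedCountRegroup`

* piece X₁ `SignedSheetPushforward` — MULTI-SHEET PUSHFORWARD (no multiplicity hypothesis, integer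
  weights): `[r] − Σ_k c_k • [Φ_k σ_k, g_k] ∈ KZ.relations` whenever `r.integrand = Σ_k c_k 1_{σ_k}
  (g_k ∘ Φ_k) |det Φ_k'|` on the co-null union of the `ℚ`-semialgebraic sheets `σ_k ⊆ r.domain`;
* piece X₂ `SignedCountRegroup` — CONSTANT SIGNED COUNT REGROUPS: sub-representations `ρ_k` of `r'`
  whose weighted indicator count `Σ_k c_k 1_{ρ_k.domain}` is a.e. the constant `D` on `r'.domain`
  satisfy `Σ_k c_k • [ρ_k] − D • [r'] ∈ KZ.relations`;
* assembly `signedSheetTransfer_of_subs : SignedSheetPushforward → SignedCountRegroup →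
  SignedSheetTransfer` (PROVED; seam = the image representations `r' | Φ_k σ_k`, which exist by the
  Tarski–Seidenberg image theorem `IsSemialgebraicMapOn.isSemialgebraic_image_holds`).

Registered stubs (the genuine lemmas of the line; sorries ONLY here):

* X₁: `stub_jacobianSemialgebraic` (the Jacobian `|det DΦ|` of a differentiable semialgebraic map
  on an open set is semialgebraic — Basu–Pollack–Roy Prop. 3.22 + Leibniz expansion),
  `stub_sheetShrink` (shrink the sheets to open semialgebraic `V_k ⊆ σ_k` off the null closed set
  `⋃_j ∂σ_j`, keeping membership in every sheet synchronised), `stub_singleSheetPush` (ONE sheet: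
  the zero-extended sheet term `[G, 1_V (g∘Φ)|det Φ'|]` minus `[Φ V, g]` is a relation — rule (2)
  plus rule (1) bookkeeping), `stub_imageNullRestrict` (dropping the image of a null set from the
  target sheet is a relation — Sard-type null image + rule (1));
* X₂: `stub_countSemialgebraic` (an integer combination of indicators of semialgebraic sets is a
  semialgebraic function), `stub_indicatorExtension` (`[E, 1_T f] − [T ∩ E, f]` is a relation).

Compositions (REAL proofs): `signedSheetPushforward_of`, `signedCountRegroup_of`,
`signedSheetTransfer_of_subs`, and `SignedSheetTransfer_of` concluding the crux BY NAME.

References: M. Kontsevich, D. Zagier, *Periods* (2001) §1.2 rules (1)–(2); J. Bochnak, M. Coste,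
M.-F. Roy, *Real Algebraic Geometry* (1998) §2.2, Prop. 2.2.7, §2.8; S. Basu, R. Pollack, M.-F. Roy,
*Algorithms in Real Algebraic Geometry* (2006) Prop. 2.83, Prop. 3.22; H. Federer, *Geometric Measure
Theory* (1969) 3.2.3–3.2.5 (area formula with multiplicities); Mathlib
`MeasureTheory.integral_image_eq_integral_abs_det_fderiv_smul`.
-/

noncomputable section

open MeasureTheory Set
open Literature.NumberTheory.Transcendental
open Literature.ModelTheory.ExponentialFields (IsSemialgebraic)

namespace Summit.KontsevichZagierPeriods.KontsevichZagierPeriods.Cruxes.SignedSheetTransfer.Split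

open Summit.KontsevichZagierPeriods.KontsevichZagierPeriods.Theses.CobordismMove
open Summit.KontsevichZagierPeriods.CobordismMove

variable {n : ℕ}

/-! ## The two pieces -/

/-- Piece X₁ (crux): MULTI-SHEET PUSHFORWARD. -/
def SignedSheetPushforward : Prop :=
  ∀ (n N : ℕ) (r : Literature.NumberTheory.Transcendental.KZ.IntegralRep n) (c : Fin N → ℤ) (σ : Fin N → Set (Fin n → ℝ)) (Φ : Fin N → (Fin n → ℝ) → (Fin n → ℝ)) (Φ' : Fin N → (Fin n → ℝ) → ((Fin n → ℝ) →L[ℝ] (Fin n → ℝ))) (ρ : Fin N → Literature.NumberTheory.Transcendental.KZ.IntegralRep n), (∀ k, Literature.ModelTheory.ExponentialFields.IsSemialgebraic ℚ (σ k)) → (∀ k, σ k ⊆ r.domain) → MeasureTheory.volume (r.domain \ ⋃ k, σ k) = 0 → (∀ k, Literature.NumberTheory.Transcendental.IsSemialgebraicMapOn ℚ (σ k) (Φ k)) → (∀ k, ∀ x ∈ σ k, HasFDerivWithinAt (Φ k) (Φ' k x) (σ k) x) → (∀ k, Set.InjOn (Φ k) (σ k)) → (∀ k, (ρ k).domain =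 Φ k '' σ k) → (∀ x ∈ ⋃ k, σ k, r.integrand x = ∑ k : Fin N, (c k : ℝ) * (σ k).indicator (fun y => (ρ k).integrand (Φ k y) * |(Φ' k y).det|) x) → Literature.NumberTheory.Transcendental.KZ.of r - ∑ k : Fin N, c k • Literature.NumberTheory.Transcendental.KZ.of (ρ k) ∈ Literature.NumberTheory.Transcendental.KZ.relations

/-- Piece X₂ (crux): CONSTANT SIGNED COUNT REGROUPS. -/
def SignedCountRegroup : Prop :=
  ∀ (n N : ℕ) (D : ℤ) (r' : Literature.NumberTheory.Transcendental.KZ.IntegralRep n) (c : Fin N → ℤ) (ρ : Fin N → Literature.NumberTheory.Transcendental.KZ.IntegralRep n), (∀ k, (ρ k).domain ⊆ r'.domain) → (∀ k, Set.EqOn (ρ k).integrand r'.integrand (ρ k).domain) → (∀ᵐ y ∂(MeasureTheory.volume.restrict r'.domain), (∑ k : Fin N, (c k : ℝ) * ((ρ k).domain).indicator (fun _ => (1 : ℝ)) y) = (D : ℝ)) → (∑ k : Fin N, c k • Literature.NumberTheory.Transcendental.KZ.of (ρ k)) - D • Literature.NumberTheory.Transcendental.KZ.of r' ∈ Literatu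re.NumberTheory.Transcendental.KZ.relations

/-! ## Assembly of the crux from the two pieces (PROVED) -/

/-- Local *reducible* alias of the crux, so that exactly ONE theorem of this file
(`SignedSheetTransfer_of`, hypothesis-free) concludes the route declaration literally by name
(skeleton audit), while the decomposition theorem below still proves `X₁ → X₂ → crux` up to `abbrev`
unfolding. -/
abbrev Crux : Prop :=
  Summit.KontsevichZagierPeriods.KontsevichZagierPeriods.Theses.CobordismMove.SignedSheetTransfer

/-- Assembly: the two pieces give `SignedSheetTransfer` (seam: the image representations
`ρ_k = r' | Φ_k σ_k`, images `ℚ`-semialgebraic by Tarski–Seidenberg). -/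
theorem signedSheetTransfer_of_subs (h₁ : SignedSheetPushforward) (h₂ : SignedCountRegroup) :
    Crux := by
  intro n N D r r' ε σ Φ Φ' hε hσ hsub hnull hmap hder hinj himg hcount hintg
  have himgsa : ∀ k, IsSemialgebraic ℚ (Φ k '' σ k) := fun k =>
    IsSemialgebraicMapOn.isSemialgebraic_image_holds (hmap k) Subset.rfl (hσ k)
  set ρ : Fin N → KZ.IntegralRep n := fun k => r'.restrict (Φ k '' σ k) (himgsa k) (himg k) with hρ
  have e₁ : KZ.of r - ∑ k : Fin N, ε k • KZ.of (ρ k) ∈ KZ.relations :=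
    h₁ n N r ε σ Φ Φ' ρ hσ hsub hnull hmap hder hinj (fun k => rfl) hintg
  have e₂ : (∑ k : Fin N, ε k • KZ.of (ρ k)) - D • KZ.of r' ∈ KZ.relations :=
    h₂ n N D r' ε ρ (fun k => himg k) (fun k => fun x _ => rfl) hcount
  have := KZ.relations.add_mem e₁ e₂
  simpa using this

/-! ## Helpers (proved) -/

/-- Finite unions of `ℚ`-semialgebraic sets indexed by `Fin N` are semialgebraic. -/
theorem isSemialgebraic_iUnion {N : ℕ} {s : Fin N → Set (Fin n → ℝ)}
    (hs : ∀ k, IsSemialgebraic ℚ (s k)) : IsSemialgebraic ℚ (⋃ k, s k) := by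
  have := Literature.ModelTheory.ExponentialFields.IsSemialgebraic.biUnion (k := ℚ) Finset.univ s
    fun k _ => hs k
  simpa using this

/-! ## Registered stubs — piece X₁ -/

/-- X₁ stub 1 (Jacobian of a semialgebraic map is semialgebraic): on an OPEN set `U`, if `Φ` is a
`ℚ`-semialgebraic map, Fréchet-differentiable at every point of `U`, then `x ↦ |det (fderiv ℝ Φ x)|`
is a `ℚ`-semialgebraic function on `U` (entries `∂_j Φ_i` semialgebraic by
`IsSemialgebraicFunOn.fderiv_apply_single`, Basu–Pollack–Roy Prop. 3.22; determinant by Leibniz,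
`IsSemialgebraicFunOn.matrix_det`; absolute value). -/
theorem stub_jacobianSemialgebraic :
    ∀ {n : ℕ} (U : Set (Fin n → ℝ)) (Φ : (Fin n → ℝ) → (Fin n → ℝ)), IsOpen U →
      IsSemialgebraicMapOn ℚ U Φ → (∀ x ∈ U, DifferentiableAt ℝ Φ x) →
      IsSemialgebraicFunOn ℚ U (fun x => |(fderiv ℝ Φ x).det|) := by
  sorry

/-- X₁ stub 2 (synchronised open shrink of the sheets): finitely many `ℚ`-semialgebraic sheets
`σ_k` admit OPEN `ℚ`-semialgebraic `V_k ⊆ σ_k` with `⋃_k (σ_k ∖ V_k)` null and such that on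
`⋃_k V_k` membership in `σ_j` and in `V_j` agree for every `j` (take `V_k = interior σ_k ∖ ⋃_j ∂σ_j`;
frontiers of semialgebraic sets are null, BCR §2.8). -/
theorem stub_sheetShrink :
    ∀ {n N : ℕ} (σ : Fin N → Set (Fin n → ℝ)), (∀ k, IsSemialgebraic ℚ (σ k)) →
      ∃ V : Fin N → Set (Fin n → ℝ), (∀ k, IsOpen (V k)) ∧ (∀ k, IsSemialgebraic ℚ (V k)) ∧
        (∀ k, V k ⊆ σ k) ∧ volume (⋃ k, (σ k \ V k)) = 0 ∧
        (∀ x ∈ ⋃ k, V k, ∀ j, x ∈ σ j → x ∈ V j) := by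
  sorry

/-- X₁ stub 3 (one sheet, zero-extended, is pushed forward by ONE change of variables): for
`ℚ`-semialgebraic `V ⊆ G`, a `ℚ`-semialgebraic map `Φ` on `V`, injective with derivative `Φ'` within
`V`, `Φ '' V ⊆ ρ.domain`, and the sheet term `h = (ρ.integrand ∘ Φ) · |det Φ'|` `ℚ`-semialgebraic on
`V`: there are representations `R = [G, 1_V h]` and `S = [Φ '' V, ρ.integrand]` with `[R] − [S] ∈
KZ.relations` (`h` integrable on `V` by Mathlib's `integrableOn_image_iff_integrableOn_abs_det_fderiv_smul`;
`[G, 1_V h] = [V, h] + [G ∖ V, 0]` by rule (1); `[V, h] − [Φ V, ρ.integrand]` is rule (2)). -/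
theorem stub_singleSheetPush :
    ∀ {n : ℕ} (G V : Set (Fin n → ℝ)) (Φ : (Fin n → ℝ) → (Fin n → ℝ))
      (Φ' : (Fin n → ℝ) → ((Fin n → ℝ) →L[ℝ] (Fin n → ℝ))) (ρ : KZ.IntegralRep n),
      IsSemialgebraic ℚ G → IsSemialgebraic ℚ V → V ⊆ G → IsSemialgebraicMapOn ℚ V Φ →
      (∀ x ∈ V, HasFDerivWithinAt Φ (Φ' x) V x) → InjOn Φ V → Φ '' V ⊆ ρ.domain →
      IsSemialgebraicFunOn ℚ V (fun x => ρ.integrand (Φ x) * |(Φ' x).det|) →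
      ∃ R S : KZ.IntegralRep n, R.domain = G ∧
        R.integrand = V.indicator (fun x => ρ.integrand (Φ x) * |(Φ' x).det|) ∧
        S.domain = Φ '' V ∧ S.integrand = ρ.integrand ∧ KZ.of R - KZ.of S ∈ KZ.relations := by
  sorry

/-- X₁ stub 4 (dropping the image of a null piece of the sheet from the target is a relation): if
`V ⊆ σ` with `σ ∖ V` null, `Φ` differentiable within `σ`, `ρ.domain = Φ '' σ` and `S = [Φ '' V,
ρ.integrand]`, then `[ρ] − [S] ∈ KZ.relations` (`Φ '' σ ∖ Φ '' V ⊆ Φ '' (σ ∖ V)` is null by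
`addHaar_image_eq_zero_of_differentiableOn_of_addHaar_eq_zero`; rule (1)). -/
theorem stub_imageNullRestrict :
    ∀ {n : ℕ} (σ V : Set (Fin n → ℝ)) (Φ : (Fin n → ℝ) → (Fin n → ℝ))
      (Φ' : (Fin n → ℝ) → ((Fin n → ℝ) →L[ℝ] (Fin n → ℝ))) (ρ S : KZ.IntegralRep n),
      V ⊆ σ → volume (σ \ V) = 0 → (∀ x ∈ σ, HasFDerivWithinAt Φ (Φ' x) σ x) →
      ρ.domain = Φ '' σ → S.domain = Φ '' V → EqOn S.integrand ρ.integrand S.domain →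
      KZ.of ρ - KZ.of S ∈ KZ.relations := by
  sorry

/-! ## Registered stubs — piece X₂ -/

/-- X₂ stub 1 (integer indicator combinations are semialgebraic functions): for `ℚ`-semialgebraic
`τ` and `T_k`, the function `y ↦ Σ_k c_k 1_{T_k}(y)` is `ℚ`-semialgebraic on `τ`. -/
theorem stub_countSemialgebraic :
    ∀ {n N : ℕ} (τ : Set (Fin n → ℝ)) (T : Fin N → Set (Fin n → ℝ)) (c : Fin N → ℤ),
      IsSemialgebraic ℚ τ → (∀ k, IsSemialgebraic ℚ (T k)) →
      IsSemialgebraicFunOn ℚ τ (fun y => ∑ k : Fin N, (c k : ℝ) * (T k).indicator (fun _ => (1 : ℝ)) y) := by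
  sorry

/-- X₂ stub 2 (indicator extension is a relation): for a representation `R`, a `ℚ`-semialgebraic
`T` and `S = [T ∩ R.domain, R.integrand]`, there is `W = [R.domain, 1_T R.integrand]` with
`[W] − [S] ∈ KZ.relations` (rule (1): `W = S + [R.domain ∖ T, 0]`). -/
theorem stub_indicatorExtension :
    ∀ {n : ℕ} (R S : KZ.IntegralRep n) (T : Set (Fin n → ℝ)), IsSemialgebraic ℚ T →
      S.domain = T ∩ R.domain → EqOn S.integrand R.integrand S.domain →
      ∃ W : KZ.IntegralRep n, W.domain = R.domain ∧ W.integrand = T.indicator R.integrand ∧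
        KZ.of W - KZ.of S ∈ KZ.relations := by
  sorry

/-! ## Piece X₂ from its stubs (PROVED) -/

theorem signedCountRegroup_of
    (H₁ : ∀ {n N : ℕ} (τ : Set (Fin n → ℝ)) (T : Fin N → Set (Fin n → ℝ)) (c : Fin N → ℤ),
      IsSemialgebraic ℚ τ → (∀ k, IsSemialgebraic ℚ (T k)) →
      IsSemialgebraicFunOn ℚ τ (fun y => ∑ k : Fin N, (c k : ℝ) * (T k).indicator (fun _ => (1 : ℝ)) y))
    (H₂ : ∀ {n : ℕ} (R S : KZ.IntegralRep n) (T : Set (Fin n → ℝ)), IsSemialgebraic ℚ T →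
      S.domain = T ∩ R.domain → EqOn S.integrand R.integrand S.domain →
      ∃ W : KZ.IntegralRep n, W.domain = R.domain ∧ W.integrand = T.indicator R.integrand ∧
        KZ.of W - KZ.of S ∈ KZ.relations) :
    SignedCountRegroup := by
  intro n N D r' c ρ hsub hint hcount
  classical
  -- notation
  set τ : Set (Fin n → ℝ) := r'.domain with hτ
  set T : Fin N → Set (Fin n → ℝ) := fun k => (ρ k).domain with hT
  set F : (Fin n → ℝ) → ℝ := fun y => ∑ k : Fin N, (c k : ℝ) * (T k).indicator (fun _ => (1 : ℝ)) y
    with hF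
  have hτsa : IsSemialgebraic ℚ τ := r'.isSemialgebraic_domain
  have hTsa : ∀ k, IsSemialgebraic ℚ (T k) := fun k => (ρ k).isSemialgebraic_domain
  have hFsa : IsSemialgebraicFunOn ℚ τ F := H₁ τ T c hτsa hTsa
  -- the good set `E = {y ∈ τ | F y = D}`
  set E : Set (Fin n → ℝ) := {y | y ∈ τ ∧ F y = (D : ℝ)} with hE
  have hEsa : IsSemialgebraic ℚ E :=
    isSemialgebraic_sep_eq hFsa (isSemialgebraicFunOn_ratCast hτsa (D : ℚ) |>.congr fun _ _ => by simp)
  have hEτ : E ⊆ τ := fun y hy => hy.1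
  have hτm : MeasurableSet τ :=
    Literature.ModelTheory.ExponentialFields.IsSemialgebraic.measurableSet_holds hτsa
  have hnull : volume (τ \ E) = 0 := by
    have h1 : ∀ᵐ y ∂volume, y ∈ τ → F y = (D : ℝ) := (ae_restrict_iff' hτm).1 hcount
    rw [ae_iff] at h1
    refine measure_mono_null (fun y hy => ?_) h1
    simp only [mem_setOf_eq, Classical.not_imp]
    exact ⟨hy.1, fun h => hy.2 ⟨hy.1, h⟩⟩
  -- restrictions to the good set
  set r'E : KZ.IntegralRep n := r'.restrict E hEsa hEτ with hr'E
  have e₀ : KZ.of r' - KZ.of r'E ∈ KZ.relations := r'.of_sub_of_restrict_mem_relations hEsa hEτ hnull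
  have hTEsa : ∀ k, IsSemialgebraic ℚ (T k ∩ E) := fun k => (hTsa k).inter hEsa
  set ρE : Fin N → KZ.IntegralRep n := fun k =>
    (ρ k).restrict (T k ∩ E) (hTEsa k) inter_subset_left with hρE
  have e₁ : ∀ k, KZ.of (ρ k) - KZ.of (ρE k) ∈ KZ.relations := fun k => by
    refine (ρ k).of_sub_of_restrict_mem_relations (hTEsa k) inter_subset_left ?_
    refine measure_mono_null (fun y hy => ?_) hnull
    exact ⟨hsub k hy.1, fun hyE => hy.2 ⟨hy.1, hyE⟩⟩
  -- the indicator extensions `W k = [E, 1_{T k} r'.integrand]`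
  have hW : ∀ k, ∃ W : KZ.IntegralRep n, W.domain = E ∧
      W.integrand = (T k).indicator r'.integrand ∧ KZ.of W - KZ.of (ρE k) ∈ KZ.relations := by
    intro k
    obtain ⟨W, hWd, hWi, hWr⟩ := H₂ r'E (ρE k) (T k) (hTsa k) rfl
      (fun y hy => hint k (show y ∈ (ρ k).domain from hy.1))
    exact ⟨W, hWd, hWi, hWr⟩
  choose W hWd hWi hWr using hW
  -- zero combination on the common domain `E`
  have hz := ZeroCombination.zeroCombination_holds n (N + 1) E (Fin.cons r'E W) (Fin.cons (-D) c)
    (fun i => Fin.cases rfl (fun k => hWd k) i) (fun y hy => by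
      rw [Fin.sum_univ_succ]
      simp only [Fin.cons_zero, Fin.cons_succ, Int.cast_neg]
      have hy' : F y = D := hy.2
      have hWy : ∀ k, (W k).integrand y = (T k).indicator (fun _ => (1 : ℝ)) y * r'.integrand y := by
        intro k
        rw [hWi k]
        by_cases hyk : y ∈ T k <;> simp [hyk]
      simp only [hWy, ← mul_assoc, ← Finset.sum_mul]
      have : (∑ k : Fin N, (c k : ℝ) * (T k).indicator (fun _ => (1 : ℝ)) y) = D := hy'
      rw [this]
      show -(D : ℝ) * r'.integrand y + (D : ℝ) * r'.integrand y = 0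
      ring)
  rw [Fin.sum_univ_succ] at hz
  simp only [Fin.cons_zero, Fin.cons_succ] at hz
  -- collect
  have e₁' : ∑ k : Fin N, c k • (KZ.of (ρ k) - KZ.of (ρE k)) ∈ KZ.relations :=
    KZ.relations.sum_mem fun k _ => KZ.relations.zsmul_mem (e₁ k) _
  have e₂' : ∑ k : Fin N, c k • (KZ.of (W k) - KZ.of (ρE k)) ∈ KZ.relations :=
    KZ.relations.sum_mem fun k _ => KZ.relations.zsmul_mem (hWr k) _
  have e₀' : D • (KZ.of r' - KZ.of r'E) ∈ KZ.relations := KZ.relations.zsmul_mem e₀ _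
  have key : (∑ k : Fin N, c k • KZ.of (ρ k)) - D • KZ.of r' =
      ∑ k : Fin N, c k • (KZ.of (ρ k) - KZ.of (ρE k)) -
        ∑ k : Fin N, c k • (KZ.of (W k) - KZ.of (ρE k)) +
        (-D • KZ.of r'E + ∑ k : Fin N, c k • KZ.of (W k)) - D • (KZ.of r' - KZ.of r'E) := by
    simp only [smul_sub, Finset.sum_sub_distrib, neg_smul]
    abel
  rw [key]
  exact KZ.relations.sub_mem (KZ.relations.add_mem (KZ.relations.sub_mem e₁' e₂') hz) e₀'


/-! ## Piece X₁ from its stubs (PROVED) -/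

theorem signedSheetPushforward_of
    (H₁ : ∀ {n : ℕ} (U : Set (Fin n → ℝ)) (Φ : (Fin n → ℝ) → (Fin n → ℝ)), IsOpen U →
      IsSemialgebraicMapOn ℚ U Φ → (∀ x ∈ U, DifferentiableAt ℝ Φ x) →
      IsSemialgebraicFunOn ℚ U (fun x => |(fderiv ℝ Φ x).det|))
    (H₂ : ∀ {n N : ℕ} (σ : Fin N → Set (Fin n → ℝ)), (∀ k, IsSemialgebraic ℚ (σ k)) →
      ∃ V : Fin N → Set (Fin n → ℝ), (∀ k, IsOpen (V k)) ∧ (∀ k, IsSemialgebraic ℚ (V k)) ∧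
        (∀ k, V k ⊆ σ k) ∧ volume (⋃ k, (σ k \ V k)) = 0 ∧
        (∀ x ∈ ⋃ k, V k, ∀ j, x ∈ σ j → x ∈ V j))
    (H₃ : ∀ {n : ℕ} (G V : Set (Fin n → ℝ)) (Φ : (Fin n → ℝ) → (Fin n → ℝ))
      (Φ' : (Fin n → ℝ) → ((Fin n → ℝ) →L[ℝ] (Fin n → ℝ))) (ρ : KZ.IntegralRep n),
      IsSemialgebraic ℚ G → IsSemialgebraic ℚ V → V ⊆ G → IsSemialgebraicMapOn ℚ V Φ →
      (∀ x ∈ V, HasFDerivWithinAt Φ (Φ' x) V x) → InjOn Φ V → Φ '' V ⊆ ρ.domain →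
      IsSemialgebraicFunOn ℚ V (fun x => ρ.integrand (Φ x) * |(Φ' x).det|) →
      ∃ R S : KZ.IntegralRep n, R.domain = G ∧
        R.integrand = V.indicator (fun x => ρ.integrand (Φ x) * |(Φ' x).det|) ∧
        S.domain = Φ '' V ∧ S.integrand = ρ.integrand ∧ KZ.of R - KZ.of S ∈ KZ.relations)
    (H₄ : ∀ {n : ℕ} (σ V : Set (Fin n → ℝ)) (Φ : (Fin n → ℝ) → (Fin n → ℝ))
      (Φ' : (Fin n → ℝ) → ((Fin n → ℝ) →L[ℝ] (Fin n → ℝ))) (ρ S : KZ.IntegralRep n),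
      V ⊆ σ → volume (σ \ V) = 0 → (∀ x ∈ σ, HasFDerivWithinAt Φ (Φ' x) σ x) →
      ρ.domain = Φ '' σ → S.domain = Φ '' V → EqOn S.integrand ρ.integrand S.domain →
      KZ.of ρ - KZ.of S ∈ KZ.relations) :
    SignedSheetPushforward := by
  intro n N r c σ Φ Φ' ρ hσ hsub hnull hmap hder hinj hρ hintg
  classical
  -- shrink the sheets
  obtain ⟨V, hVo, hVsa, hVσ, hVnull, hVmem⟩ := H₂ σ hσ
  have hGsa : IsSemialgebraic ℚ (⋃ k, V k) := isSemialgebraic_iUnion hVsa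
  have hGσ : (⋃ k, V k) ⊆ ⋃ k, σ k := iUnion_mono hVσ
  have hGr : (⋃ k, V k) ⊆ r.domain := hGσ.trans (iUnion_subset hsub)
  -- derivative facts on the open pieces
  have hnhds : ∀ k, ∀ x ∈ V k, σ k ∈ nhds x := fun k x hx =>
    Filter.mem_of_superset ((hVo k).mem_nhds hx) (hVσ k)
  have hderAt : ∀ k, ∀ x ∈ V k, HasFDerivAt (Φ k) (Φ' k x) x := fun k x hx =>
    (hder k x (hVσ k hx)).hasFDerivAt (hnhds k x hx)
  have hfd : ∀ k, ∀ x ∈ V k, fderiv ℝ (Φ k) x = Φ' k x := fun k x hx => (hderAt k x hx).fderiv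
  -- the sheet term is semialgebraic on `V k`
  have hmapV : ∀ k, IsSemialgebraicMapOn ℚ (V k) (Φ k) := fun k => (hmap k).mono (hVσ k) (hVsa k)
  have hhsa : ∀ k, IsSemialgebraicFunOn ℚ (V k)
      (fun y => (ρ k).integrand (Φ k y) * |(Φ' k y).det|) := by
    intro k
    have hcomp : IsSemialgebraicFunOn ℚ (V k) ((ρ k).integrand ∘ Φ k) :=
      IsSemialgebraicFunOn.comp_isSemialgebraicMapOn_holds (ρ k).isSemialgebraicFunOn_integrand
        (hmapV k) (fun x hx => by rw [hρ k]; exact mem_image_of_mem _ (hVσ k hx))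
    have hjac : IsSemialgebraicFunOn ℚ (V k) (fun x => |(fderiv ℝ (Φ k) x).det|) :=
      H₁ (V k) (Φ k) (hVo k) (hmapV k) (fun x hx => (hderAt k x hx).differentiableAt)
    refine (IsSemialgebraicFunOn.mul_holds hcomp hjac).congr fun x hx => ?_
    simp [hfd k x hx]
  -- per-sheet pushforward (one change of variables each)
  have hRS : ∀ k, ∃ R S : KZ.IntegralRep n, R.domain = (⋃ k, V k) ∧
      R.integrand = (V k).indicator (fun y => (ρ k).integrand (Φ k y) * |(Φ' k y).det|) ∧
      S.domain = Φ k '' V k ∧ S.integrand = (ρ k).integrand ∧ KZ.of R - KZ.of S ∈ KZ.relations :=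
    fun k => H₃ (⋃ k, V k) (V k) (Φ k) (Φ' k) (ρ k) hGsa (hVsa k) (subset_iUnion V k) (hmapV k)
      (fun x hx => (hder k x (hVσ k hx)).mono (hVσ k)) ((hinj k).mono (hVσ k))
      (by rw [hρ k]; exact image_mono (hVσ k)) (hhsa k)
  choose R S hRd hRi hSd hSi hRS' using hRS
  -- the null part of each target sheet
  have e₂ : ∀ k, KZ.of (ρ k) - KZ.of (S k) ∈ KZ.relations := fun k =>
    H₄ (σ k) (V k) (Φ k) (Φ' k) (ρ k) (S k) (hVσ k)
      (measure_mono_null (subset_iUnion (fun k => σ k \ V k) k) hVnull) (hder k) (hρ k) (hSd k)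
      (fun y _ => by rw [hSi k])
  -- restrict `r` to the open co-null set `⋃ V k`
  have e₀ : KZ.of r - KZ.of (r.restrict (⋃ k, V k) hGsa hGr) ∈ KZ.relations := by
    refine r.of_sub_of_restrict_mem_relations hGsa hGr (measure_mono_null (fun x hx => ?_)
      (measure_union_null hnull hVnull))
    by_cases hxσ : x ∈ ⋃ k, σ k
    · obtain ⟨k, hk⟩ := mem_iUnion.1 hxσ
      exact Or.inr (mem_iUnion.2 ⟨k, hk, fun hxV => hx.2 (mem_iUnion.2 ⟨k, hxV⟩)⟩)
    · exact Or.inl ⟨hx.1, hxσ⟩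
  -- zero combination on the common domain `⋃ V k`
  have hz := ZeroCombination.zeroCombination_holds n (N + 1) (⋃ k, V k)
    (Fin.cons (r.restrict (⋃ k, V k) hGsa hGr) R) (Fin.cons (-1) c)
    (fun i => Fin.cases rfl (fun k => hRd k) i) (fun x hx => by
      rw [Fin.sum_univ_succ]
      simp only [Fin.cons_zero, Fin.cons_succ, Int.cast_neg, Int.cast_one,
        KZ.IntegralRep.integrand_restrict]
      have h2 : ∀ k, (σ k).indicator (fun y => (ρ k).integrand (Φ k y) * |(Φ' k y).det|) x =
          (R k).integrand x := by
        intro k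
        rw [hRi k]
        by_cases hxk : x ∈ σ k
        · rw [indicator_of_mem hxk, indicator_of_mem (hVmem x hx k hxk)]
        · rw [indicator_of_notMem hxk, indicator_of_notMem (fun h' => hxk (hVσ k h'))]
      rw [hintg x (hGσ hx)]
      simp only [h2]
      ring)
  rw [Fin.sum_univ_succ] at hz
  simp only [Fin.cons_zero, Fin.cons_succ, neg_smul, one_smul] at hz
  -- collect
  have e₁' : ∑ k : Fin N, c k • (KZ.of (R k) - KZ.of (S k)) ∈ KZ.relations :=
    KZ.relations.sum_mem fun k _ => KZ.relations.zsmul_mem (hRS' k) _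
  have e₂' : ∑ k : Fin N, c k • (KZ.of (ρ k) - KZ.of (S k)) ∈ KZ.relations :=
    KZ.relations.sum_mem fun k _ => KZ.relations.zsmul_mem (e₂ k) _
  have key : KZ.of r - ∑ k : Fin N, c k • KZ.of (ρ k) =
      (KZ.of r - KZ.of (r.restrict (⋃ k, V k) hGsa hGr)) -
        (-KZ.of (r.restrict (⋃ k, V k) hGsa hGr) + ∑ k : Fin N, c k • KZ.of (R k)) +
        ∑ k : Fin N, c k • (KZ.of (R k) - KZ.of (S k)) -
        ∑ k : Fin N, c k • (KZ.of (ρ k) - KZ.of (S k)) := by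
    simp only [smul_sub, Finset.sum_sub_distrib]
    abel
  rw [key]
  exact KZ.relations.sub_mem (KZ.relations.add_mem (KZ.relations.sub_mem e₀ hz) e₁') e₂'

/-! ## The crux from the six registered stubs (PROVED composition) -/

/-- The crux (as `Crux`) from the six stub STATEMENTS (kernel-checked composition). -/
theorem crux_of_stubStatements :
    (∀ {n : ℕ} (U : Set (Fin n → ℝ)) (Φ : (Fin n → ℝ) → (Fin n → ℝ)), IsOpen U →
      IsSemialgebraicMapOn ℚ U Φ → (∀ x ∈ U, DifferentiableAt ℝ Φ x) →
      IsSemialgebraicFunOn ℚ U (fun x => |(fderiv ℝ Φ x).det|)) →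
    (∀ {n N : ℕ} (σ : Fin N → Set (Fin n → ℝ)), (∀ k, IsSemialgebraic ℚ (σ k)) →
      ∃ V : Fin N → Set (Fin n → ℝ), (∀ k, IsOpen (V k)) ∧ (∀ k, IsSemialgebraic ℚ (V k)) ∧
        (∀ k, V k ⊆ σ k) ∧ volume (⋃ k, (σ k \ V k)) = 0 ∧
        (∀ x ∈ ⋃ k, V k, ∀ j, x ∈ σ j → x ∈ V j)) →
    (∀ {n : ℕ} (G V : Set (Fin n → ℝ)) (Φ : (Fin n → ℝ) → (Fin n → ℝ))
      (Φ' : (Fin n → ℝ) → ((Fin n → ℝ) →L[ℝ] (Fin n → ℝ))) (ρ : KZ.IntegralRep n),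
      IsSemialgebraic ℚ G → IsSemialgebraic ℚ V → V ⊆ G → IsSemialgebraicMapOn ℚ V Φ →
      (∀ x ∈ V, HasFDerivWithinAt Φ (Φ' x) V x) → InjOn Φ V → Φ '' V ⊆ ρ.domain →
      IsSemialgebraicFunOn ℚ V (fun x => ρ.integrand (Φ x) * |(Φ' x).det|) →
      ∃ R S : KZ.IntegralRep n, R.domain = G ∧
        R.integrand = V.indicator (fun x => ρ.integrand (Φ x) * |(Φ' x).det|) ∧
        S.domain = Φ '' V ∧ S.integrand = ρ.integrand ∧ KZ.of R - KZ.of S ∈ KZ.relations) →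
    (∀ {n : ℕ} (σ V : Set (Fin n → ℝ)) (Φ : (Fin n → ℝ) → (Fin n → ℝ))
      (Φ' : (Fin n → ℝ) → ((Fin n → ℝ) →L[ℝ] (Fin n → ℝ))) (ρ S : KZ.IntegralRep n),
      V ⊆ σ → volume (σ \ V) = 0 → (∀ x ∈ σ, HasFDerivWithinAt Φ (Φ' x) σ x) →
      ρ.domain = Φ '' σ → S.domain = Φ '' V → EqOn S.integrand ρ.integrand S.domain →
      KZ.of ρ - KZ.of S ∈ KZ.relations) →
    (∀ {n N : ℕ} (τ : Set (Fin n → ℝ)) (T : Fin N → Set (Fin n → ℝ)) (c : Fin N → ℤ),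
      IsSemialgebraic ℚ τ → (∀ k, IsSemialgebraic ℚ (T k)) →
      IsSemialgebraicFunOn ℚ τ (fun y => ∑ k : Fin N, (c k : ℝ) * (T k).indicator (fun _ => (1 : ℝ)) y)) →
    (∀ {n : ℕ} (R S : KZ.IntegralRep n) (T : Set (Fin n → ℝ)), IsSemialgebraic ℚ T →
      S.domain = T ∩ R.domain → EqOn S.integrand R.integrand S.domain →
      ∃ W : KZ.IntegralRep n, W.domain = R.domain ∧ W.integrand = T.indicator R.integrand ∧
        KZ.of W - KZ.of S ∈ KZ.relations) →
    Crux :=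
  fun H₁ H₂ H₃ H₄ H₅ H₆ =>
    signedSheetTransfer_of_subs (signedSheetPushforward_of H₁ H₂ H₃ H₄) (signedCountRegroup_of H₅ H₆)

/-- THE SKELETON THEOREM: `SignedSheetTransfer` (the route declaration, BY NAME) from the six
registered stubs of this file — `sorry` occurs only inside `stub_*`. -/
theorem SignedSheetTransfer_of :
    Summit.KontsevichZagierPeriods.KontsevichZagierPeriods.Theses.CobordismMove.SignedSheetTransfer :=
  crux_of_stubStatements stub_jacobianSemialgebraic stub_sheetShrink stub_singleSheetPush
    stub_imageNullRestrict stub_countSemialgebraic stub_indicatorExtension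

end Summit.KontsevichZagierPeriods.KontsevichZagierPeriods.Cruxes.SignedSheetTransfer.Split
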